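import Summits.BirchSwinnertonDyer.BirchSwinnertonDyer.Theses.ErratumRoadFive
import Summits.BirchSwinnertonDyer.Rank1Residual.X11a.PrintDischargeMuTableRecords
import HarnessLib

/-!
# Route `ErratumRoadFive` (K2), crux `NonSurjCorner` (19065), gen-3 child 23047 `NonSurjCornerTwinMuAnDeep`:
# THE TABLE DOOR FOR THE DEEP CHILD — the live decl from a kernel-checkable μ symbol table at every Friedberg–Hoffstein twist of
# every DEEP corner pair (cell `bsd-stepL`, WIDTH-LEVER lane B `bsd-stepL-corner5-p2` g12; `--supports stmt-BirchSwinnertonDyer-23047 --as helper`)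

WHY. Lane B's table door of record (`NonSurjTwin.twinMuAn_of_forall_muTable`, g8, `…TwinMuAnOfTables.lean`) concludes the RETIRED full-class
child 19948. The μ symbol tables this lane now lands for the live DEEP child (`…TwinMuAnTablesDeepPart1.lean`, p681917: the Friedberg–Hoffstein
twists `E*^{(−111)}`, `E*^{(−311)}` of the one known deep pair) are in the same x11a schema `MuTable`; this file is the door that consumes them
BY NAME for the LIVE decl: `Theses.ErratumRoadFive.NonSurjCornerTwinMuAnDeep` follows, granted Mazur's fact on the Manin constant, from — at every
DEEP corner pair `(E,p)` and every Friedberg–Hoffstein twin `Wd = Cd • E^{(d_K)}` — a displayed central value `L(Wd,1) = ℓ·Ω_{Wd}` with `‖ℓ‖_p ≤ 1`,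
a table `t` at `p` passing the kernel recheck `t.checkRiemannSum` (unit Riemann sum at the displayed index), the split-bit consistency, and the
table's claim `t.ClaimFor Wd` (D-0014 claim level) — x11a's per-pair door `ClassX11a.muAnZeroAt_of_muTable_of_lRatio` at each twin, then the split ∕ non-split case split of g12's
`NonSurjCornerDeep.twinMuAnDeep_of_laneCertificatesDeep` (p676733; re-proved inline here so that this file imports the route file only, not a
Theorems module above it).

HONEST FRAMING: ONE bookkeeping theorem (no definition, no new named fact, no `sorry`); CONDITIONAL on Mazur's fact by name and on the per-twin
claims; the `∀` over the deep pairs and their Heegner fields is exactly what is open (Greenberg's Conj. 1.11 on the corner's classes; at the known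
deep pair already the third Heegner field needs a depth-2 table, memo CORNER5-P2-G12 §2); items 19065 ∕ 23047 stay OPEN; closes: none (T7);
BSD is proved for no curve or class.
References: [MazurTateTeitelbaum1986Invent] §I.10 Prop., §I.12–I.14; [Mazur1978] Cor. 4.1; [SteinWuthrich2013] §3, §4.2; [GreenbergLNM1716]
§1 Conj. 1.11 (p. 61); tree: x11a `X11a/PrintDischargeMuTableRecords.lean`, g8 `…TwinMuAnOfTables.lean`, g12 `…TwinMuAnDeepUnitTwins.lean`.
-/

set_option autoImplicit false
set_option linter.dupNamespace false -- `Summit.BirchSwinnertonDyer.BirchSwinnertonDyer` (summit = problem), tree-wide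

noncomputable section

open scoped Classical NumberField MatrixGroups ModularForm

namespace Summit.BirchSwinnertonDyer.BirchSwinnertonDyer.Theorems

open CongruenceSubgroup WeierstrassCurve Literature.NumberTheory.EllipticCurves
  Literature.NumberTheory.EllipticCurves.ModularForms
  Literature.NumberTheory.EllipticCurves.Rank1Residual
  Literature.NumberTheory.EllipticCurves.Rank1Residual.X11aPrintCertificates
  Summit.BirchSwinnertonDyer.Rank1Residual

/-- **23047 from a kernel-checkable μ symbol table at every Friedberg–Hoffstein twist of every DEEP corner pair.** Granted Mazur's
fact `mazur_not_dvd_maninConstant_of_odd`: if at every deep corner pair `(E,p)` (`ClassX11b`, `ρ̄` not onto, `p ∈ {5,7}`, `p ∣ ord_p Δ_min`, no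
(ram) witness, `0 < ord_p #Ш(E)_an`) every twin `Wd = Cd • E^{(d_K)}` (`K` imaginary quadratic, Heegner for `N_E`, `L(E^{(d_K)},1) ≠ 0`; `Wd` a
non-surjective X11a leaf with `p ∣ ord_p Δ_min`) has a displayed central value `L(Wd,1) = ℓ·Ω_{Wd}` with `‖ℓ‖_p ≤ 1` and a μ symbol table `t` at
`p` with `t.checkRiemannSum = true`, the split-bit consistency and the claim `t.ClaimFor Wd`, then the route decl
`Theses.ErratumRoadFive.NonSurjCornerTwinMuAnDeep`. The deep analogue of `NonSurjTwin.twinMuAn_of_forall_muTable` (g8).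
CONDITIONAL; nothing booked. [cite: MazurTateTeitelbaum1986Invent, §I.10 Prop., §I.12–I.14] [cite: Mazur1978, Cor. 4.1]
[cite: SteinWuthrich2013, §3 and §4.2] [cite: GreenbergLNM1716, §1 Conj. 1.11 (p. 61)] -/
theorem NonSurjCornerDeep.twinMuAnDeep_of_forall_muTableDeep (hM : mazur_not_dvd_maninConstant_of_odd)
    (h : ∀ (W : WeierstrassCurve ℚ) [W.IsElliptic] [W.IsGloballyMinimal] (p : ℕ) [Fact p.Prime],
      ClassX11b W p → ¬ Surj W p → (p = 5 ∨ p = 7) → p ∣ padicValInt p W.minimalDiscriminantInt →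
      ¬ Ram W p → (∃ s : ℚ, shaAn W = (s : ℂ) ∧ 0 < padicValRat p s) →
      ∀ (K : Type) [Field K] [NumberField K] (Wd : WeierstrassCurve ℚ) [Wd.IsElliptic] [Wd.IsGloballyMinimal]
        (Cd : VariableChange ℚ),
        IsImaginaryQuadratic K → SatisfiesHeegnerHypothesis (W.conductorNorm ℤ) K →
        (W.quadraticTwist (NumberField.discr K : ℚ)).entireLFunction 1 ≠ 0 →
        Cd • W.quadraticTwist (NumberField.discr K : ℚ) = Wd →
        ClassX11a Wd p → ¬ Surj Wd p → p ∣ padicValInt p Wd.minimalDiscriminantInt →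
        ∃ (ℓ : ℚ) (t : MuTable), Wd.entireLFunction 1 = (ℓ : ℂ) * (Wd.realPeriodRat : ℂ) ∧
          ‖((ℓ : ℚ) : ℚ_[p])‖ ≤ 1 ∧ t.p = p ∧ t.checkRiemannSum = true ∧
          (Wd.HasSplitMultiplicativeReductionAtPrime p → t.split = true) ∧ t.ClaimFor Wd) :
    Summit.BirchSwinnertonDyer.BirchSwinnertonDyer.Theses.ErratumRoadFive.NonSurjCornerTwinMuAnDeep := by
  show Summit.BirchSwinnertonDyer.BirchSwinnertonDyer.Theorems.NonSurjCornerTwinMuAnDeep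
  intro W _ _ p _ hX hns h57 hv hnram hsha K _ _ Wd _ _ Cd hK hHN hL1 hWd hXa hnsd hvd N _ f hf ϖ hϖ a L hsa hna hL
  obtain ⟨ℓ, t, hℓ, hℓ1, hp, ht, hts, hT⟩ := h W p hX hns h57 hv hnram hsha K Wd Cd hK hHN hL1 hWd hXa hnsd hvd
  -- the X11a lane certificate at the twin, from the table (x11a's per-pair door)
  obtain ⟨hnsp, hsp⟩ := hXa.muAnZeroAt_of_muTable_of_lRatio hM ℓ hℓ hℓ1 t hp ht hts hT f hf ϖ hϖ
  by_cases hsplit : Wd.HasSplitMultiplicativeReductionAtPrime p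
  · have ha : a = 1 := hsa hsplit
    subst ha
    exact hsp hsplit L ((isMultPAdicLFunctionOf_one_iff L).mp hL)
  · have ha : a = -1 := hna hsplit
    subst ha
    exact hnsp hsplit L hL

end Summit.BirchSwinnertonDyer.BirchSwinnertonDyer.Theorems

end
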